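import Summits.ValiantsHypothesis.ValiantsHypothesis.Theorems.KPlusLogSqLawMixedGaugeOneFastModeRatioThreeHalves

/-!
# Route «KPlusLogSqLaw», `WeakLifting` (stmt-ValiantsHypothesis-19561) — TWO-CLASS MIXED VERTEX GAUGE with ANY number of fast
# modes: at most `n + m` UPWARD zeros (ratios 3 and 3 : 2), and the downward pair law

HONEST FRAMING.  Helper file (seat val-sym-lift-p4 g26, cell `pub-symmetroid`, 2026-08-29; `--supports 19561 --as helper`, zero
crux credit), third of the seat's mixed-gauge series (✓ `…MixedGaugeOneFastMode`, `…RatioThreeHalves`).  Object: the two-class mixed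
vertex gauge with `n` slow POSITIVE modes and `m` fast NEGATIVE modes,
`M(x) = [[A + x^a·1ₙ, B], [Bᵀ, C − x^b·1ₘ]]` (`A ∈ Sym(n)`, `C ∈ Sym(m)`, `B` real `n × m`).  LOCATED LAW (seat memo MIXED-GAUGE-LAW.md,
exact Sturm certification): the maximal number of positive determinant zeros is `n + 2m` for every ratio `b/a > 1` tried, attained by
direct sums, and in every extremiser the zeros split as EXACTLY `n + m` «upward» (kernel vector `(w, q)` with
`a‖w‖² > b x^{b−a}‖q‖²`, the vanishing eigenvalue increases) plus `m` «downward».  THIS FILE PROVES THE UPWARD HALF for the two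
elementary ratios: any finite set of positive `x` each carrying an UPWARD kernel vector has at most `n + m` elements —
`card_up_le_blocks` (exponents `a, 3a`) and `card_up_le_blocks_threeHalves` (exponents `2a, 3a`).  Mechanism: the block two-point
identity `(s' − s)·⟪w,w'⟫ = (t' − t)·⟪q,q'⟫` (`two_point_blocks`, symmetry of `A` AND `C`, any `B`), a relation `Σ dⱼ wⱼ = 0`,
`Σ dⱼ qⱼ = 0` among `n + m + 1` kernel vectors (dimension count), and the expansions of the ratio-3 / ratio-3:2 files with `⟪qⱼ,qₖ⟫`
in place of `qⱼ qₖ`: at ratio 3 the cross term `2⟪Σ dⱼ sⱼ² qⱼ, Σ dₖ qₖ⟫` dies on the relation and `‖Σ dⱼ sⱼ qⱼ‖²` survives; at ratio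
3 : 2 the coordinatewise Hilbert–Cauchy form survives.  The DOWNWARD half (`≤ m` downward zeros) is LOCATED ONLY for `m ≥ 2`; what
is proved here is the pair law `down_pair_blocks`: two distinct downward zeros have fast components with
`(s² + ss' + s'²)²⟪q,q'⟫² ≤ 9 s² s'² ‖q‖² ‖q'‖²` (cos² < 1; for `m = 1` this is the `not_two_down` of the first file).
Nothing here is about `WeakLifting` / `TropicalB` in their windows, the doors, `MatrixDescartes` (18050) or VP ≠ VNP.
No `def`; axioms standard.  [folklore linear algebra]
-/

set_option linter.dupNamespace false
set_option autoImplicit false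

namespace Summit.ValiantsHypothesis.ValiantsHypothesis.Theorems.KPlusLogSqLaw

open Matrix Finset
open scoped BigOperators

namespace MixedGauge

variable {n m : ℕ}

/-! ## 1. The block two-point identity -/

/-- **Block two-point identity.**  `A`, `C` real symmetric, `B` arbitrary: if `(A + s·1) w + B q = 0`, `Bᵀ w + (C − t·1) q = 0` and the
same for `(w', q')` at `(s', t')`, then `(s' − s)·⟪w,w'⟫ = (t' − t)·⟪q,q'⟫`. -/
theorem two_point_blocks (A : Matrix (Fin n) (Fin n) ℝ) (hA : A.IsSymm) (C : Matrix (Fin m) (Fin m) ℝ) (hC : C.IsSymm)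
    (B : Matrix (Fin n) (Fin m) ℝ) (s t s' t' : ℝ) (w w' : Fin n → ℝ) (q q' : Fin m → ℝ)
    (h1 : (A + s • (1 : Matrix (Fin n) (Fin n) ℝ)) *ᵥ w + B *ᵥ q = 0)
    (h2 : Bᵀ *ᵥ w + (C - t • (1 : Matrix (Fin m) (Fin m) ℝ)) *ᵥ q = 0)
    (h1' : (A + s' • (1 : Matrix (Fin n) (Fin n) ℝ)) *ᵥ w' + B *ᵥ q' = 0)
    (h2' : Bᵀ *ᵥ w' + (C - t' • (1 : Matrix (Fin m) (Fin m) ℝ)) *ᵥ q' = 0) :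
    (s' - s) * (w ⬝ᵥ w') = (t' - t) * (q ⬝ᵥ q') := by
  have e1 : w' ⬝ᵥ ((A + s • (1 : Matrix (Fin n) (Fin n) ℝ)) *ᵥ w + B *ᵥ q) = 0 := by rw [h1, dotProduct_zero]
  have e1' : w ⬝ᵥ ((A + s' • (1 : Matrix (Fin n) (Fin n) ℝ)) *ᵥ w' + B *ᵥ q') = 0 := by rw [h1', dotProduct_zero]
  have e2 : q' ⬝ᵥ (Bᵀ *ᵥ w + (C - t • (1 : Matrix (Fin m) (Fin m) ℝ)) *ᵥ q) = 0 := by rw [h2, dotProduct_zero]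
  have e2' : q ⬝ᵥ (Bᵀ *ᵥ w' + (C - t' • (1 : Matrix (Fin m) (Fin m) ℝ)) *ᵥ q') = 0 := by rw [h2', dotProduct_zero]
  have hAs : w' ⬝ᵥ (A *ᵥ w) = w ⬝ᵥ (A *ᵥ w') := by
    rw [dotProduct_mulVec, ← Matrix.mulVec_transpose, hA.eq, dotProduct_comm]
  have hCs : q' ⬝ᵥ (C *ᵥ q) = q ⬝ᵥ (C *ᵥ q') := by
    rw [dotProduct_mulVec, ← Matrix.mulVec_transpose, hC.eq, dotProduct_comm]
  have hB1 : w' ⬝ᵥ (B *ᵥ q) = q ⬝ᵥ (Bᵀ *ᵥ w') := by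
    rw [dotProduct_mulVec, ← Matrix.mulVec_transpose, dotProduct_comm]
  have hB2 : w ⬝ᵥ (B *ᵥ q') = q' ⬝ᵥ (Bᵀ *ᵥ w) := by
    rw [dotProduct_mulVec, ← Matrix.mulVec_transpose, dotProduct_comm]
  rw [add_mulVec, dotProduct_add, dotProduct_add, Matrix.smul_mulVec, one_mulVec, dotProduct_smul] at e1 e1'
  rw [sub_mulVec, dotProduct_add, dotProduct_sub, Matrix.smul_mulVec, one_mulVec, dotProduct_smul] at e2 e2'
  rw [hAs, hB1, dotProduct_comm w' w] at e1
  rw [hB2] at e1'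
  rw [hCs, dotProduct_comm q' q] at e2
  simp only [smul_eq_mul] at e1 e1' e2 e2'
  linear_combination e1' - e1 - e2 + e2'

/-! ## 2. Ratio three: at most `n + m` upward zeros -/

/-- **Upward law, ratio 3, any number of fast modes.**  `n + m + 1` pairwise distinct `sⱼ`, vectors `wⱼ ∈ ℝⁿ`, `qⱼ ∈ ℝᵐ` with the
pairwise identities `(sₖ − sⱼ)·⟪wⱼ,wₖ⟫ = (sₖ³ − sⱼ³)·⟪qⱼ,qₖ⟫` and all upward (`3 sⱼ² ‖qⱼ‖² < ‖wⱼ‖²`) cannot exist. -/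
theorem up_card_le_blocks (s : Fin (n + m + 1) → ℝ) (hinj : Function.Injective s)
    (w : Fin (n + m + 1) → (Fin n → ℝ)) (q : Fin (n + m + 1) → (Fin m → ℝ))
    (hid : ∀ j k, j ≠ k → (s k - s j) * (w j ⬝ᵥ w k) = (s k ^ 3 - s j ^ 3) * (q j ⬝ᵥ q k))
    (hup : ∀ j, 3 * s j ^ 2 * (q j ⬝ᵥ q j) < w j ⬝ᵥ w j) : False := by
  classical
  let f : (Fin (n + m + 1) → ℝ) →ₗ[ℝ] ((Fin n → ℝ) × (Fin m → ℝ)) :=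
    { toFun := fun d => (∑ j, d j • w j, ∑ j, d j • q j)
      map_add' := by
        intro d d'
        simp only [Pi.add_apply, add_smul, Finset.sum_add_distrib, Prod.mk_add_mk]
      map_smul' := by
        intro r d
        simp only [Pi.smul_apply, smul_eq_mul, mul_smul, ← Finset.smul_sum, RingHom.id_apply, Prod.smul_mk] }
  have hker : LinearMap.ker f ≠ ⊥ := by
    apply LinearMap.ker_ne_bot_of_finrank_lt
    rw [Module.finrank_prod, Module.finrank_fin_fun, Module.finrank_fin_fun, Module.finrank_fin_fun]
    omega
  obtain ⟨d, hdker, hd0⟩ := (Submodule.ne_bot_iff _).mp hker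
  have hfd : f d = 0 := LinearMap.mem_ker.mp hdker
  have hsumw : ∑ j, d j • w j = 0 := (Prod.mk_eq_zero.mp hfd).1
  have hsumq : ∑ j, d j • q j = 0 := (Prod.mk_eq_zero.mp hfd).2
  have hG : ∀ j k, w j ⬝ᵥ w k =
      (s j ^ 2 + s j * s k + s k ^ 2) * (q j ⬝ᵥ q k) + (if j = k then w j ⬝ᵥ w j - 3 * s j ^ 2 * (q j ⬝ᵥ q j) else 0) := by
    intro j k
    by_cases hjk : j = k
    · subst hjk
      rw [if_pos rfl]
      ring
    · rw [if_neg hjk, add_zero]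
      have hne : s k - s j ≠ 0 := sub_ne_zero.mpr (fun h => hjk (hinj h).symm)
      have h := hid j k hjk
      have h' : (s k - s j) * (w j ⬝ᵥ w k) = (s k - s j) * ((s j ^ 2 + s j * s k + s k ^ 2) * (q j ⬝ᵥ q k)) := by
        rw [h]; ring
      exact mul_left_cancel₀ hne h'
  have hzero : (∑ j, d j • w j) ⬝ᵥ (∑ k, d k • w k) = 0 := by rw [hsumw, dotProduct_zero]
  have hexp : (∑ j, d j • w j) ⬝ᵥ (∑ k, d k • w k) = ∑ j, ∑ k, d j * d k * (w j ⬝ᵥ w k) := by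
    rw [sum_dotProduct]
    refine Finset.sum_congr rfl fun j _ => ?_
    rw [dotProduct_sum]
    refine Finset.sum_congr rfl fun k _ => ?_
    rw [smul_dotProduct, dotProduct_smul, smul_eq_mul, smul_eq_mul]
    ring
  -- termwise: three dot products of rescaled fast vectors plus the positive diagonal
  have hterm : ∀ j k, d j * d k * (w j ⬝ᵥ w k) =
      ((d j * s j ^ 2) • q j) ⬝ᵥ (d k • q k) + ((d j * s j) • q j) ⬝ᵥ ((d k * s k) • q k)
        + (d j • q j) ⬝ᵥ ((d k * s k ^ 2) • q k)
        + (if j = k then d j ^ 2 * (w j ⬝ᵥ w j - 3 * s j ^ 2 * (q j ⬝ᵥ q j)) else 0) := by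
    intro j k
    rw [hG j k]
    simp only [smul_dotProduct, dotProduct_smul, smul_eq_mul]
    by_cases hjk : j = k
    · subst hjk; simp only [if_pos]; ring
    · simp only [if_neg hjk]; ring
  have hpair : ∀ X Y : Fin (n + m + 1) → Fin m → ℝ, (∑ j, X j) ⬝ᵥ (∑ k, Y k) = ∑ j, ∑ k, X j ⬝ᵥ Y k := by
    intro X Y
    rw [sum_dotProduct]
    refine Finset.sum_congr rfl fun j _ => ?_
    rw [dotProduct_sum]
  have hdouble : ∑ j, ∑ k, d j * d k * (w j ⬝ᵥ w k) =
      (∑ j, (d j * s j ^ 2) • q j) ⬝ᵥ (∑ k, d k • q k) + (∑ j, (d j * s j) • q j) ⬝ᵥ (∑ k, (d k * s k) • q k)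
        + (∑ j, d j • q j) ⬝ᵥ (∑ k, (d k * s k ^ 2) • q k)
        + ∑ j, d j ^ 2 * (w j ⬝ᵥ w j - 3 * s j ^ 2 * (q j ⬝ᵥ q j)) := by
    rw [hpair, hpair, hpair]
    simp_rw [hterm, Finset.sum_add_distrib, Finset.sum_ite_eq, Finset.mem_univ, if_true]
  rw [hexp, hdouble, hsumq, dotProduct_zero, zero_dotProduct, zero_add, add_zero] at hzero
  have hsq : 0 ≤ (∑ j, (d j * s j) • q j) ⬝ᵥ (∑ k, (d k * s k) • q k) := by
    rw [dotProduct]; exact Finset.sum_nonneg fun i _ => mul_self_nonneg _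
  have hdiag : 0 < ∑ j, d j ^ 2 * (w j ⬝ᵥ w j - 3 * s j ^ 2 * (q j ⬝ᵥ q j)) := by
    obtain ⟨j0, hj0⟩ : ∃ j, d j ≠ 0 := by
      by_contra h
      push Not at h
      exact hd0 (funext h)
    apply Finset.sum_pos'
    · intro j _
      exact mul_nonneg (sq_nonneg _) (by linarith [hup j])
    · exact ⟨j0, Finset.mem_univ _, mul_pos (by positivity) (by linarith [hup j0])⟩
  linarith

/-! ## 3. Ratio 3 : 2: at most `n + m` upward zeros -/

/-- **Upward law, ratio 3 : 2, any number of fast modes** (variable `p = x^a`): `n + m + 1` distinct positive `pⱼ`, vectors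
`wⱼ ∈ ℝⁿ`, `qⱼ ∈ ℝᵐ` with `(pₖ² − pⱼ²)·⟪wⱼ,wₖ⟫ = (pₖ³ − pⱼ³)·⟪qⱼ,qₖ⟫` pairwise and all upward (`3 pⱼ ‖qⱼ‖² < 2‖wⱼ‖²`) cannot
exist. -/
theorem up_card_le_blocks_threeHalves (p : Fin (n + m + 1) → ℝ) (hp : ∀ j, 0 < p j) (hinj : Function.Injective p)
    (w : Fin (n + m + 1) → (Fin n → ℝ)) (q : Fin (n + m + 1) → (Fin m → ℝ))
    (hid : ∀ j k, j ≠ k → (p k ^ 2 - p j ^ 2) * (w j ⬝ᵥ w k) = (p k ^ 3 - p j ^ 3) * (q j ⬝ᵥ q k))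
    (hup : ∀ j, 3 * p j * (q j ⬝ᵥ q j) < 2 * (w j ⬝ᵥ w j)) : False := by
  classical
  let f : (Fin (n + m + 1) → ℝ) →ₗ[ℝ] ((Fin n → ℝ) × (Fin m → ℝ)) :=
    { toFun := fun d => (∑ j, d j • w j, ∑ j, d j • q j)
      map_add' := by
        intro d d'
        simp only [Pi.add_apply, add_smul, Finset.sum_add_distrib, Prod.mk_add_mk]
      map_smul' := by
        intro r d
        simp only [Pi.smul_apply, smul_eq_mul, mul_smul, ← Finset.smul_sum, RingHom.id_apply, Prod.smul_mk] }
  have hker : LinearMap.ker f ≠ ⊥ := by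
    apply LinearMap.ker_ne_bot_of_finrank_lt
    rw [Module.finrank_prod, Module.finrank_fin_fun, Module.finrank_fin_fun, Module.finrank_fin_fun]
    omega
  obtain ⟨d, hdker, hd0⟩ := (Submodule.ne_bot_iff _).mp hker
  have hfd : f d = 0 := LinearMap.mem_ker.mp hdker
  have hsumw : ∑ j, d j • w j = 0 := (Prod.mk_eq_zero.mp hfd).1
  have hsumq : ∑ j, d j • q j = 0 := (Prod.mk_eq_zero.mp hfd).2
  have hG : ∀ j k, j ≠ k → (w j ⬝ᵥ w k) * (p j + p k) = (p j ^ 2 + p j * p k + p k ^ 2) * (q j ⬝ᵥ q k) := by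
    intro j k hjk
    have hne : p k - p j ≠ 0 := sub_ne_zero.mpr (fun h => hjk (hinj h).symm)
    have h := hid j k hjk
    have h' : (p k - p j) * ((w j ⬝ᵥ w k) * (p j + p k)) =
        (p k - p j) * ((p j ^ 2 + p j * p k + p k ^ 2) * (q j ⬝ᵥ q k)) := by
      have e1 : (p k - p j) * ((w j ⬝ᵥ w k) * (p j + p k)) = (p k ^ 2 - p j ^ 2) * (w j ⬝ᵥ w k) := by ring
      have e2 : (p k - p j) * ((p j ^ 2 + p j * p k + p k ^ 2) * (q j ⬝ᵥ q k)) =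
          (p k ^ 3 - p j ^ 3) * (q j ⬝ᵥ q k) := by ring
      rw [e1, e2, h]
    exact mul_left_cancel₀ hne h'
  -- Φ ≡ 0 on the relation
  have hPhi0 : ∑ j, ∑ k, d j * d k * (p k ^ 2 * (w j ⬝ᵥ w k) - p k ^ 3 * (q j ⬝ᵥ q k)) = 0 := by
    have hsplit : ∀ j k, d j * d k * (p k ^ 2 * (w j ⬝ᵥ w k) - p k ^ 3 * (q j ⬝ᵥ q k)) =
        (d k * p k ^ 2) * ((d j • w j) ⬝ᵥ w k) - (d k * p k ^ 3) * ((d j • q j) ⬝ᵥ q k) := by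
      intro j k
      rw [smul_dotProduct, smul_dotProduct, smul_eq_mul, smul_eq_mul]
      ring
    simp_rw [hsplit, Finset.sum_sub_distrib]
    rw [Finset.sum_comm]
    simp_rw [← Finset.mul_sum, ← sum_dotProduct, hsumw, zero_dotProduct, mul_zero, Finset.sum_const_zero, zero_sub,
      neg_eq_zero]
    rw [Finset.sum_comm]
    simp_rw [← Finset.mul_sum, ← sum_dotProduct, hsumq, zero_dotProduct, mul_zero, Finset.sum_const_zero]
  -- Φ termwise: coordinatewise Hilbert–Cauchy form plus the positive diagonal
  have hterm : ∀ j k, d j * d k * (p k ^ 2 * (w j ⬝ᵥ w k) - p k ^ 3 * (q j ⬝ᵥ q k)) =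
      (∑ i, ((d j * p j ^ 2) * q j i) * ((d k * p k ^ 2) * q k i) / (p j + p k))
        + (if j = k then d j ^ 2 * p j ^ 2 * ((w j ⬝ᵥ w j) - 3 / 2 * p j * (q j ⬝ᵥ q j)) else 0) := by
    intro j k
    have hjk_pos : 0 < p j + p k := add_pos (hp j) (hp k)
    have hsum : ∑ i, ((d j * p j ^ 2) * q j i) * ((d k * p k ^ 2) * q k i) / (p j + p k) =
        (d j * p j ^ 2) * (d k * p k ^ 2) * (q j ⬝ᵥ q k) / (p j + p k) := by
      rw [dotProduct, Finset.mul_sum, Finset.sum_div]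
      refine Finset.sum_congr rfl fun i _ => ?_
      ring
    rw [hsum]
    by_cases hjk : j = k
    · subst hjk
      rw [if_pos rfl]
      field_simp
      ring
    · rw [if_neg hjk, add_zero]
      have hg := hG j k hjk
      rw [eq_div_iff (ne_of_gt hjk_pos)]
      have : d j * d k * (p k ^ 2 * (w j ⬝ᵥ w k) - p k ^ 3 * (q j ⬝ᵥ q k)) * (p j + p k) =
          d j * d k * (p k ^ 2 * ((w j ⬝ᵥ w k) * (p j + p k)) - p k ^ 3 * (q j ⬝ᵥ q k) * (p j + p k)) := by ring
      rw [this, hg]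
      ring
  have hdouble : ∑ j, ∑ k, d j * d k * (p k ^ 2 * (w j ⬝ᵥ w k) - p k ^ 3 * (q j ⬝ᵥ q k)) =
      (∑ j, ∑ k, ∑ i, ((d j * p j ^ 2) * q j i) * ((d k * p k ^ 2) * q k i) / (p j + p k))
        + ∑ j, d j ^ 2 * p j ^ 2 * ((w j ⬝ᵥ w j) - 3 / 2 * p j * (q j ⬝ᵥ q j)) := by
    simp_rw [hterm, Finset.sum_add_distrib, Finset.sum_ite_eq, Finset.mem_univ, if_true]
  -- the triple sum is a sum over coordinates of Hilbert–Cauchy forms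
  have hH : 0 ≤ ∑ j, ∑ k, ∑ i, ((d j * p j ^ 2) * q j i) * ((d k * p k ^ 2) * q k i) / (p j + p k) := by
    have hcomm : ∑ j, ∑ k, ∑ i, ((d j * p j ^ 2) * q j i) * ((d k * p k ^ 2) * q k i) / (p j + p k) =
        ∑ i, ∑ j, ∑ k, ((d j * p j ^ 2) * q j i) * ((d k * p k ^ 2) * q k i) / (p j + p k) := by
      calc (∑ j, ∑ k, ∑ i, ((d j * p j ^ 2) * q j i) * ((d k * p k ^ 2) * q k i) / (p j + p k))
          = ∑ j, ∑ i, ∑ k, ((d j * p j ^ 2) * q j i) * ((d k * p k ^ 2) * q k i) / (p j + p k) :=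
            Finset.sum_congr rfl fun j _ => Finset.sum_comm
        _ = ∑ i, ∑ j, ∑ k, ((d j * p j ^ 2) * q j i) * ((d k * p k ^ 2) * q k i) / (p j + p k) := Finset.sum_comm
    rw [hcomm]
    exact Finset.sum_nonneg fun i _ => cauchy_quadratic_nonneg (n + m + 1) p (fun j => (d j * p j ^ 2) * q j i) hp
  have hdiag : 0 < ∑ j, d j ^ 2 * p j ^ 2 * ((w j ⬝ᵥ w j) - 3 / 2 * p j * (q j ⬝ᵥ q j)) := by
    obtain ⟨j0, hj0⟩ : ∃ j, d j ≠ 0 := by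
      by_contra h
      push Not at h
      exact hd0 (funext h)
    apply Finset.sum_pos'
    · intro j _
      exact mul_nonneg (mul_nonneg (sq_nonneg _) (sq_nonneg _)) (by linarith [hup j])
    · exact ⟨j0, Finset.mem_univ _, mul_pos (mul_pos (by positivity) (pow_pos (hp j0) 2)) (by linarith [hup j0])⟩
  rw [hdouble] at hPhi0
  linarith

/-! ## 4. The downward pair law (ratio 3) -/

/-- **Downward pair law (ratio 3).**  Two downward kernel vectors (`‖w‖² ≤ 3 s² ‖q‖²`, `‖w'‖² ≤ 3 s'² ‖q'‖²`) at points related by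
the two-point identity with `t = s³` have fast components at a definite angle:
`(s² + ss' + s'²)²·⟪q,q'⟫² ≤ 9 s² s'²·‖q‖²‖q'‖²` (and `s² + ss' + s'² > 3ss'` unless `s = s'`). -/
theorem down_pair_blocks (s s' : ℝ) (hne : s ≠ s') (w w' : Fin n → ℝ) (q q' : Fin m → ℝ)
    (hid : (s' - s) * (w ⬝ᵥ w') = (s' ^ 3 - s ^ 3) * (q ⬝ᵥ q'))
    (hd : w ⬝ᵥ w ≤ 3 * s ^ 2 * (q ⬝ᵥ q)) (hd' : w' ⬝ᵥ w' ≤ 3 * s' ^ 2 * (q' ⬝ᵥ q')) :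
    (s ^ 2 + s * s' + s' ^ 2) ^ 2 * (q ⬝ᵥ q') ^ 2 ≤ 9 * (s ^ 2 * s' ^ 2) * ((q ⬝ᵥ q) * (q' ⬝ᵥ q')) := by
  have hCS : (w ⬝ᵥ w') ^ 2 ≤ (w ⬝ᵥ w) * (w' ⬝ᵥ w') := by
    have h := Finset.sum_mul_sq_le_sq_mul_sq (Finset.univ : Finset (Fin n)) w w'
    simpa only [dotProduct, pow_two] using h
  have hww : 0 ≤ w ⬝ᵥ w := by rw [dotProduct]; exact Finset.sum_nonneg fun i _ => mul_self_nonneg _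
  have hww' : 0 ≤ w' ⬝ᵥ w' := by rw [dotProduct]; exact Finset.sum_nonneg fun i _ => mul_self_nonneg _
  have hqq : 0 ≤ q ⬝ᵥ q := by rw [dotProduct]; exact Finset.sum_nonneg fun i _ => mul_self_nonneg _
  have hqq' : 0 ≤ q' ⬝ᵥ q' := by rw [dotProduct]; exact Finset.sum_nonneg fun i _ => mul_self_nonneg _
  have hprod : (w ⬝ᵥ w) * (w' ⬝ᵥ w') ≤ (3 * s ^ 2 * (q ⬝ᵥ q)) * (3 * s' ^ 2 * (q' ⬝ᵥ q')) :=
    mul_le_mul hd hd' hww' (by positivity)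
  have hsq : (s' - s) ^ 2 * (w ⬝ᵥ w') ^ 2 = (s' ^ 3 - s ^ 3) ^ 2 * (q ⬝ᵥ q') ^ 2 := by
    have := congrArg (fun z => z ^ 2) hid
    simpa [mul_pow] using this
  have hD : 0 < (s' - s) ^ 2 := by
    have : s' - s ≠ 0 := sub_ne_zero.mpr (Ne.symm hne)
    positivity
  have hfac : (s' ^ 3 - s ^ 3) ^ 2 = (s' - s) ^ 2 * (s ^ 2 + s * s' + s' ^ 2) ^ 2 := by ring
  have h1 : (s' - s) ^ 2 * ((s ^ 2 + s * s' + s' ^ 2) ^ 2 * (q ⬝ᵥ q') ^ 2) ≤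
      (s' - s) ^ 2 * (9 * (s ^ 2 * s' ^ 2) * ((q ⬝ᵥ q) * (q' ⬝ᵥ q'))) := by
    have : (s' - s) ^ 2 * ((s ^ 2 + s * s' + s' ^ 2) ^ 2 * (q ⬝ᵥ q') ^ 2) = (s' - s) ^ 2 * (w ⬝ᵥ w') ^ 2 := by
      rw [hsq, hfac]; ring
    rw [this]
    nlinarith
  exact le_of_mul_le_mul_left h1 hD

/-! ## 5. The upward laws for finite sets of zeros of the block pencils -/

/-- **UPWARD ZEROS ARE AT MOST `n + m` (ratio 3).**  `A ∈ Sym(n)`, `C ∈ Sym(m)`, `B` real, `1 ≤ a`: a finite set `S` of positive `x`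
each admitting an UPWARD kernel vector `(w, q)` of `[[A + x^a·1, B], [Bᵀ, C − x^{3a}·1]]` (`3 x^{2a} ‖q‖² < ‖w‖²`) has `#S ≤ n + m`. -/
theorem card_up_le_blocks (A : Matrix (Fin n) (Fin n) ℝ) (hA : A.IsSymm) (C : Matrix (Fin m) (Fin m) ℝ) (hC : C.IsSymm)
    (B : Matrix (Fin n) (Fin m) ℝ) (a : ℕ) (ha : 1 ≤ a) (S : Finset ℝ)
    (hS : ∀ x ∈ S, 0 < x ∧ ∃ w : Fin n → ℝ, ∃ q : Fin m → ℝ,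
      (A + (x ^ a) • (1 : Matrix (Fin n) (Fin n) ℝ)) *ᵥ w + B *ᵥ q = 0 ∧
      Bᵀ *ᵥ w + (C - (x ^ (3 * a)) • (1 : Matrix (Fin m) (Fin m) ℝ)) *ᵥ q = 0 ∧
      3 * (x ^ a) ^ 2 * (q ⬝ᵥ q) < w ⬝ᵥ w) :
    S.card ≤ n + m := by
  classical
  have hx : ∀ x : S, 0 < (x : ℝ) := fun x => (hS x x.2).1
  choose W Q hWQ using fun x : S => (hS x x.2).2
  have hpow3 : ∀ x : ℝ, x ^ (3 * a) = (x ^ a) ^ 3 := fun x => by rw [mul_comm, pow_mul]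
  have hsinj : ∀ x y : S, (x : ℝ) ^ a = (y : ℝ) ^ a → x = y := by
    intro x y h
    have ha0 : a ≠ 0 := by omega
    exact Subtype.ext ((pow_left_inj₀ (hx x).le (hx y).le ha0).mp h)
  have hid : ∀ x y : S, ((y : ℝ) ^ a - (x : ℝ) ^ a) * (W x ⬝ᵥ W y) =
      (((y : ℝ) ^ a) ^ 3 - ((x : ℝ) ^ a) ^ 3) * (Q x ⬝ᵥ Q y) := by
    intro x y
    have h := two_point_blocks A hA C hC B ((x : ℝ) ^ a) ((x : ℝ) ^ (3 * a)) ((y : ℝ) ^ a) ((y : ℝ) ^ (3 * a))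
      (W x) (W y) (Q x) (Q y) (hWQ x).1 (hWQ x).2.1 (hWQ y).1 (hWQ y).2.1
    rw [hpow3, hpow3] at h
    exact h
  by_contra hlt
  push Not at hlt
  obtain ⟨T, hTsub, hTcard⟩ := Finset.exists_subset_card_eq (show n + m + 1 ≤ S.card by omega)
  let e : Fin (n + m + 1) ≃ T := (T.equivFinOfCardEq hTcard).symm
  let emb : Fin (n + m + 1) → S := fun j => ⟨(e j : ℝ), hTsub (e j).2⟩
  have hembinj : Function.Injective emb := by
    intro j k h
    have h' : ((emb j : S) : ℝ) = ((emb k : S) : ℝ) := congrArg Subtype.val h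
    exact e.injective (Subtype.ext h')
  refine up_card_le_blocks (fun j => ((emb j : S) : ℝ) ^ a) ?_ (fun j => W (emb j)) (fun j => Q (emb j)) ?_ ?_
  · intro j k h
    exact hembinj (hsinj _ _ h)
  · intro j k _
    exact hid (emb j) (emb k)
  · intro j
    exact (hWQ (emb j)).2.2

/-- **UPWARD ZEROS ARE AT MOST `n + m` (ratio 3 : 2).**  Same with exponents `2a, 3a` and upwardness `3 x^a ‖q‖² < 2‖w‖²`. -/
theorem card_up_le_blocks_threeHalves (A : Matrix (Fin n) (Fin n) ℝ) (hA : A.IsSymm) (C : Matrix (Fin m) (Fin m) ℝ)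
    (hC : C.IsSymm) (B : Matrix (Fin n) (Fin m) ℝ) (a : ℕ) (ha : 1 ≤ a) (S : Finset ℝ)
    (hS : ∀ x ∈ S, 0 < x ∧ ∃ w : Fin n → ℝ, ∃ q : Fin m → ℝ,
      (A + (x ^ (2 * a)) • (1 : Matrix (Fin n) (Fin n) ℝ)) *ᵥ w + B *ᵥ q = 0 ∧
      Bᵀ *ᵥ w + (C - (x ^ (3 * a)) • (1 : Matrix (Fin m) (Fin m) ℝ)) *ᵥ q = 0 ∧
      3 * (x ^ a) * (q ⬝ᵥ q) < 2 * (w ⬝ᵥ w)) :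
    S.card ≤ n + m := by
  classical
  have hx : ∀ x : S, 0 < (x : ℝ) := fun x => (hS x x.2).1
  choose W Q hWQ using fun x : S => (hS x x.2).2
  have hpow2 : ∀ x : ℝ, x ^ (2 * a) = (x ^ a) ^ 2 := fun x => by rw [mul_comm, pow_mul]
  have hpow3 : ∀ x : ℝ, x ^ (3 * a) = (x ^ a) ^ 3 := fun x => by rw [mul_comm, pow_mul]
  have hsinj : ∀ x y : S, (x : ℝ) ^ a = (y : ℝ) ^ a → x = y := by
    intro x y h
    have ha0 : a ≠ 0 := by omega
    exact Subtype.ext ((pow_left_inj₀ (hx x).le (hx y).le ha0).mp h)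
  have hid : ∀ x y : S, (((y : ℝ) ^ a) ^ 2 - ((x : ℝ) ^ a) ^ 2) * (W x ⬝ᵥ W y) =
      (((y : ℝ) ^ a) ^ 3 - ((x : ℝ) ^ a) ^ 3) * (Q x ⬝ᵥ Q y) := by
    intro x y
    have h := two_point_blocks A hA C hC B ((x : ℝ) ^ (2 * a)) ((x : ℝ) ^ (3 * a)) ((y : ℝ) ^ (2 * a))
      ((y : ℝ) ^ (3 * a)) (W x) (W y) (Q x) (Q y) (hWQ x).1 (hWQ x).2.1 (hWQ y).1 (hWQ y).2.1
    rw [hpow2, hpow2, hpow3, hpow3] at h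
    exact h
  by_contra hlt
  push Not at hlt
  obtain ⟨T, hTsub, hTcard⟩ := Finset.exists_subset_card_eq (show n + m + 1 ≤ S.card by omega)
  let e : Fin (n + m + 1) ≃ T := (T.equivFinOfCardEq hTcard).symm
  let emb : Fin (n + m + 1) → S := fun j => ⟨(e j : ℝ), hTsub (e j).2⟩
  have hembinj : Function.Injective emb := by
    intro j k h
    have h' : ((emb j : S) : ℝ) = ((emb k : S) : ℝ) := congrArg Subtype.val h
    exact e.injective (Subtype.ext h')
  refine up_card_le_blocks_threeHalves (fun j => ((emb j : S) : ℝ) ^ a) (fun j => pow_pos (hx (emb j)) a) ?_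
    (fun j => W (emb j)) (fun j => Q (emb j)) ?_ ?_
  · intro j k h
    exact hembinj (hsinj _ _ h)
  · intro j k _
    exact hid (emb j) (emb k)
  · intro j
    exact (hWQ (emb j)).2.2

end MixedGauge

end Summit.ValiantsHypothesis.ValiantsHypothesis.Theorems.KPlusLogSqLaw
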